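import Summits.HubbardSuperconductivity.HubbardLadder.Bounds.AttractiveStiffnessCeilingDensityTPrime
import Summits.HubbardSuperconductivity.HubbardLadder.Bounds.ThermalStiffnessCeilingTPrime
import Literature.MathematicalPhysics.QuantumLattice.SectorVariationalBounds
import Literature.MathematicalPhysics.QuantumLattice.GibbsEntropy
import Literature.MathematicalPhysics.QuantumLattice.LiebFluxPhaseProofs
import HarnessLib

/-!
# Hubbard ladder — Bounds: the density-proportional attractive kinetic ceiling at `T > 0`
# (bounds.tex Thm 9(v), `t–t'` class, typed AND proved; entropy constant halved)

HONEST FRAMING (cell pub-hubbard): ladder R1–R4 with certified numbers; no claim on H/H₀. These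
are bounds for a MODEL CLASS — the attractive `t–t'` Hubbard torus `hubbardTorusTT' L 1 t' U`
(`t = 1`, any real `t'`, `U < 0`, square torus `(ℤ/Lℤ)²`) in a canonical `(2m, S^z = 0)` Gibbs
state at inverse temperature `β > 0`; no materials claim. Companion text:
`pub-hubbard/paper/bounds.tex` §Theorem 9; tables `pub-hubbard/pub-hubbard-bounds/BOUNDS.md`
(row T7) and `EXTREMISERS.md` §5b.

## What is proved (no `sorry`, no new axioms), `τ := 1 + |t'|`, `N_p := dim` of the sector

* `re_gibbsState_self_le_groundEnergy_add` — generic: `Re⟨H⟩_β ≤ E₀(H) + (log dim)/β`.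
* `groundEnergy_toBlock_le_re_apply` — generic: `E₀(M|_p) ≤ Re M_{ii}` for `p i`.
* `posSemidef_toBlock_pairBreakingDefect` — the pair-breaking floor of Thm 9(i)
  (`pairBreaking_le_re_expect_hubbardTorusTT'`) as an OPERATOR inequality on every `N`-particle
  coordinate sector: `(H^{tt'}(U') - (U' + 8τ(ω - ω⁻¹)) D + 4ωτN·1)|_p ≥ 0` (`ω ≥ 1`).
* `neg_re_gibbsState_hopping_le_attractive_density` — **Thm 9(v)**: for every coordinate sector
  `p` of `2m`-particle occupation sets containing the fully paired ones (`m ≤ L²`),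
  `⟨-T_{tt'}⟩_{β,p} := -Re⟨H^{tt'}(0)|_p⟩_{β, H^{tt'}(U)|_p} ≤ 256 τ² m/|U| + (log N_p)/β`.
  Proof: `k := ⟨-T⟩_β`, `d := ⟨D⟩_β ≥ 0`; Gibbs positivity on the compressed floor defect at
  `U/2` gives `-8ωτm + (U/2 + 8τ(ω-ω⁻¹)) d ≤ -k + (U/2) d`; the entropy bound and the paired
  trial configuration give `-k + U d = Re⟨H⟩_β ≤ E₀ + (log N_p)/β ≤ U m + (log N_p)/β`; then the
  arithmetic of Thm 9(ii) (`a = |U|/(16τ)`, `ω = a + a⁻¹`). The every-state floor is applied to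
  the Gibbs state directly, so the entropy enters ONCE (the free-energy route of bounds.tex,
  Peierls–Bogoliubov between `U` and `U/2`, pays `2 (log N_p)/β`).
* `ThermalAttractiveKineticCeilingDensityTT'` / `…_holds` — the display as a node, for the
  `(2m, S^z = 0)` sectors in the convention of route `LogColdTorus`.

Honest numbers: as at `T = 0` (Thm 9(ii): `256 τ² m/|U|` for every unit sector ground state) the
constant is loose by more than an order of magnitude against second-order perturbation theory
(`⟨-T⟩ ≈ 16 m t²/|U|` for dilute pairs); the content is the CLASS (every `L`, every `β > 0`,
every filling, every `t'`) and the scaling `O(m t²/|U|) + T·(entropy of the sector)`. The thermal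
superfluid-STIFFNESS ceilings built on this file (Thm 9(iii),(vi) at `T > 0`: the landed thermal
f-sum floor `thermalStiffnessTT'_mul_sq_le_kinetic` + rotation covariance of the sector Gibbs
state) live in the companion file `ThermalAttractiveStiffnessCeiling.lean`.

References (keys of `lean/references.bib`): ScalapinoWhiteZhang1993 §II;
ParamekantiTrivediRanderia1998 eq. (3), §IV; HazraVermaRanderia2019 §III, App. G; XuEtAl2024
eq. (1); MicnasRanningerRobaszkiewicz1990 §IV; Tasaki2020 §2.1 (variational principle).
-/

noncomputable section

namespace Summit.HubbardSuperconductivity.HubbardLadder.Bounds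

open Matrix Finset Real
open Literature.MathematicalPhysics.QuantumLattice
open Literature.MathematicalPhysics.QuantumFieldTheory
open Literature.Probability.LatticeModels
open scoped ComplexOrder ComplexConjugate

/-! ### Generic thermal lemmas -/

section Generic

variable {n : Type*} [Fintype n] [DecidableEq n]

/-- **Mean energy ≤ ground energy + entropy budget.** For Hermitian `H` on a non-empty space and
`β > 0`: `Re⟨H⟩_β ≤ E₀(H) + (log dim)/β` (`S_β = log Z_β + β Re⟨H⟩_β ≤ log dim`,
`Z_β ≥ e^{-βE₀}`). -/
theorem re_gibbsState_self_le_groundEnergy_add [Nonempty n] {H : Matrix n n ℂ}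
    (hH : H.IsHermitian) {β : ℝ} (hβ : 0 < β) :
    (gibbsState β H H).re ≤ H.groundEnergy + Real.log (Fintype.card n) / β := by
  have hS := hH.gibbsEntropy_le_log_card β
  rw [gibbsEntropy_def] at hS
  have hZ : -(β * H.groundEnergy) ≤ Real.log (partitionFn β H).re :=
    (Real.le_log_iff_exp_le (partitionFn_re_pos hH β)).2
      (exp_neg_mul_groundEnergy_le_partitionFn hH β)
  have h : ((gibbsState β H H).re - H.groundEnergy) ≤ Real.log (Fintype.card n) / β := by
    rw [le_div_iff₀ hβ]
    have e : ((gibbsState β H H).re - H.groundEnergy) * β =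
        β * (gibbsState β H H).re - β * H.groundEnergy := by ring
    rw [e]
    linarith
  linarith

/-- **Rayleigh at a basis vector of a compression**: `E₀(M|_p) ≤ Re M_{ii}` for `p i`. -/
theorem groundEnergy_toBlock_le_re_apply {M : Matrix n n ℂ} (hM : M.IsHermitian) (p : n → Prop)
    [DecidablePred p] (i : n) (hi : p i) : (M.toBlock p p).groundEnergy ≤ (M i i).re := by
  have hMp : (M.toBlock p p).IsHermitian := hM.submatrix _
  have h := Matrix.groundEnergy_le_rayleigh_holds hMp (Pi.single (⟨i, hi⟩ : {a // p a}) (1 : ℂ))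
    (Literature.Computability.AlgebraicComplexity.star_single_dotProduct_single _)
  rw [Literature.Computability.AlgebraicComplexity.star_single_dotProduct_mulVec_single,
    toBlock_apply] at h
  exact h

end Generic

/-! ### The pair-breaking floor as an operator inequality on a particle-number sector -/

variable {L : ℕ} [NeZero L]

omit [NeZero L] in
/-- The double-occupancy operator `D = Σ_x n_{x↑} n_{x↓}` of the torus is Hermitian. -/
theorem isHermitian_doubleOcc :
    (∑ x : FermionTorus 2 L, numberOp x 0 * numberOp x 1 :
      Matrix (Finset (Orb (FermionTorus 2 L))) (Finset (Orb (FermionTorus 2 L))) ℂ).IsHermitian :=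
  by
  rw [sum_numberOp_mul_numberOp_eq_diagonal]
  refine Matrix.IsHermitian.ext fun s t => ?_
  simp only [diagonal, of_apply]
  by_cases h : s = t
  · subst h
    simp
  · have h' : t ≠ s := Ne.symm h
    simp [h, h']

omit [NeZero L] in
/-- `D = Σ_x n_{x↑} n_{x↓} ≥ 0` on the Fock space of the torus (`D(φ) ≥ 0` for every `φ`). -/
theorem posSemidef_doubleOcc :
    (∑ x : FermionTorus 2 L, numberOp x 0 * numberOp x 1 :
      Matrix (Finset (Orb (FermionTorus 2 L))) (Finset (Orb (FermionTorus 2 L))) ℂ).PosSemidef :=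
  PosSemidef.of_dotProduct_mulVec_nonneg isHermitian_doubleOcc fun φ =>
    Complex.nonneg_iff.2
      ⟨doubleOccExp_nonneg φ, (isHermitian_doubleOcc.im_star_dotProduct_mulVec_self φ).symm⟩

omit [NeZero L] in
/-- `H^{tt'}(U') = H^{tt'}(U) + (U' - U) D` as operators. -/
theorem hubbardTorusTT'_eq_add_smul_doubleOcc (t' U U' : ℝ) :
    hubbardTorusTT' L 1 t' U' = hubbardTorusTT' L 1 t' U +
      ((U' - U : ℝ) : ℂ) • ∑ x : FermionTorus 2 L, numberOp x 0 * numberOp x 1 := by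
  rw [hubbardTorusTT', hubbardTorusTT',
    DoubleOccupancy.hamiltonian_eq_add_smul (fermionTorusGraph 2 L) 1 U U']
  abel

/-- **The pair-breaking floor is an operator inequality on every `N`-particle coordinate sector**
(`τ = 1 + |t'|`, `ω ≥ 1`, every `U'`): if `p s → |s| = N`, then
`(H^{tt'}(U') - (U' + 8τ(ω - ω⁻¹)) D + 4ωτN·1)|_p ≥ 0` — the every-unit-vector floor
`pairBreaking_le_re_expect_hubbardTorusTT'`, made homogeneous (`rayleigh_of_unit`) and read on
extensions by zero of block vectors. -/
theorem posSemidef_toBlock_pairBreakingDefect (t' U' : ℝ) {ω : ℝ} (hω : 1 ≤ ω) (N : ℕ)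
    (p : Finset (Orb (FermionTorus 2 L)) → Prop) [DecidablePred p] (hpN : ∀ s, p s → s.card = N) :
    ((hubbardTorusTT' L 1 t' U' -
        ((U' + 8 * (1 + |t'|) * (ω - ω⁻¹) : ℝ) : ℂ) •
          (∑ x : FermionTorus 2 L, numberOp x 0 * numberOp x 1) +
        ((4 * ω * (1 + |t'|) * N : ℝ) : ℂ) • 1).toBlock p p).PosSemidef := by
  set A := hubbardTorusTT' L 1 t' U' -
    ((U' + 8 * (1 + |t'|) * (ω - ω⁻¹) : ℝ) : ℂ) •
      (∑ x : FermionTorus 2 L, numberOp x 0 * numberOp x 1) +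
    ((4 * ω * (1 + |t'|) * N : ℝ) : ℂ) • 1 with hA
  have hAh : A.IsHermitian :=
    ((hubbardTorusTT'_isHermitian L 1 t' U').sub
      (isHermitian_ofReal_smul isHermitian_doubleOcc _)).add
        (isHermitian_ofReal_smul isHermitian_one _)
  refine PosSemidef.of_dotProduct_mulVec_nonneg (hAh.submatrix Subtype.val) fun φ => ?_
  -- extension by zero of the block vector, and the every-unit-vector floor made homogeneous
  set v : Fock (Orb (FermionTorus 2 L)) := fun b => if h : p b then φ ⟨b, h⟩ else 0 with hv
  have hvsupp : ∀ b, ¬ p b → v b = 0 := fun b hb => by simp [hv, hb]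
  have hφv : φ = fun a : {a // p a} => v a.1 := (restrict_extend p φ).symm
  have hfloor : ∀ w : Fock (Orb (FermionTorus 2 L)), (∀ b, ¬ p b → w b = 0) → star w ⬝ᵥ w = 1 →
      (0 : ℝ) ≤ (star w ⬝ᵥ A *ᵥ w).re := by
    intro w hw hw1
    have hN : IsNParticle N w := fun s hs => hw s fun hps => hs (hpN s hps)
    have h := pairBreaking_le_re_expect_hubbardTorusTT' (L := L) t' U' hω hN hw1
    unfold doubleOccExp at h
    simp only [hA, add_mulVec, sub_mulVec, smul_mulVec, one_mulVec, dotProduct_add,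
      dotProduct_sub, dotProduct_smul, hw1, Complex.add_re, Complex.sub_re, smul_eq_mul,
      Complex.re_ofReal_mul, mul_one, Complex.ofReal_re]
    linarith
  have hray := rayleigh_of_unit hfloor v hvsupp
  rw [zero_mul] at hray
  have hform : star φ ⬝ᵥ A.toBlock p p *ᵥ φ = star v ⬝ᵥ A *ᵥ v := by
    rw [hφv]
    exact star_restrict_dotProduct_toBlock_mulVec p _ v hvsupp
  rw [hform]
  exact Complex.nonneg_iff.2 ⟨hray, (hAh.im_star_dotProduct_mulVec_self v).symm⟩

omit [NeZero L] in
/-- The fully paired configuration has energy `U · #A` in the `t–t'` torus: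
`Re H^{tt'}(U)_{ss} = U · #A` for `s = A↑ ∪ A↓` (no diagonal hopping matrix elements). -/
theorem re_hubbardTorusTT'_apply_pairSet (t' U : ℝ) (A : Finset (FermionTorus 2 L)) :
    ((hubbardTorusTT' L 1 t' U) (pairSet A A) (pairSet A A)).re = U * A.card := by
  rw [← Literature.Computability.AlgebraicComplexity.star_single_dotProduct_mulVec_single
    (hubbardTorusTT' L 1 t' U) (pairSet A A)]
  have hnn : (star (Pi.single (pairSet A A) (1 : ℂ)) ⬝ᵥ
      (hamiltonian (fermionTorusGraph 2 L) 1 U *ᵥ Pi.single (pairSet A A) 1)).re = U * A.card := by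
    convert star_single_pairSet_self_hamiltonian (fermionTorusGraph 2 L) 1 U A
  have hdg : (star (Pi.single (pairSet A A) (1 : ℂ)) ⬝ᵥ
      (hamiltonian (fermionTorusDiagGraph L) t' 0 *ᵥ Pi.single (pairSet A A) 1)).re =
        0 * A.card := by
    convert star_single_pairSet_self_hamiltonian (fermionTorusDiagGraph L) t' 0 A
  simp only [hubbardTorusTT', Matrix.add_mulVec, dotProduct_add, Complex.add_re, hnn, hdg]
  ring

/-! ### The thermal kinetic ceiling -/

/-- Arithmetic of Thm 9(v) (`a = |U|/(16τ)`, `ω = a + a⁻¹`, `d ≥ 0`): the floor at `U/2` read in the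
Gibbs state, `-4ωτ(2m) + (U/2 + 8τ(ω - ω⁻¹)) d ≤ -k + (U/2) d`, and the thermal upper bracket
`-k + U d ≤ U m + ε` give `k ≤ 256 τ² m/|U| + ε`. -/
theorem kin_le_of_brackets_arith_thermal {k d U m τ ε a ω : ℝ} (hU : U < 0) (hτ : 0 < τ)
    (hd : 0 ≤ d) (ha : a = -U / (16 * τ)) (hω : ω = a + a⁻¹) (hωa : a ≤ ω - ω⁻¹)
    (hlow : -(4 * ω * τ * (2 * m)) + (U / 2 + 8 * τ * (ω - ω⁻¹)) * d ≤ -k + U / 2 * d)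
    (hup : -k + U * d ≤ U * m + ε) : k ≤ 256 * τ ^ 2 * m / (-U) + ε := by
  have e : 8 * τ * a = -U / 2 := by
    rw [ha]
    field_simp
    ring
  have hcoef : 0 ≤ U / 2 + 8 * τ * (ω - ω⁻¹) := by
    nlinarith [mul_le_mul_of_nonneg_left hωa (by positivity : (0 : ℝ) ≤ 8 * τ)]
  have h5 := mul_nonneg hcoef hd
  have hU0 : -U ≠ 0 := by linarith
  have key : m * (16 * τ * ω + U) = 256 * τ ^ 2 * m / (-U) := by
    rw [hω, ha]
    field_simp
    ring
  rw [← key]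
  linarith

/-- **Thm 9(v): the thermal kinetic ceiling, `t–t'` class** (`U < 0`, `β > 0`, `m ≤ L²`,
`τ = 1 + |t'|`). For every coordinate sector `p` of `2m`-particle occupation sets containing the
fully paired ones (`A↑ ∪ A↓`, `#A = m`), the Gibbs state of `H^{tt'}(U)|_p` at inverse
temperature `β` has kinetic energy
`⟨-T_{tt'}⟩_{β,p} = -Re⟨H^{tt'}(0)|_p⟩_{β,p} ≤ 256 τ² m/|U| + (log N_p)/β`, `N_p = dim p`. -/
theorem neg_re_gibbsState_hopping_le_attractive_density (t' : ℝ) {U β : ℝ} (hU : U < 0)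
    (hβ : 0 < β) {m : ℕ} (hm : m ≤ L ^ 2) (p : Finset (Orb (FermionTorus 2 L)) → Prop)
    [DecidablePred p] [Nonempty {a // p a}] (hpN : ∀ s, p s → s.card = 2 * m)
    (hpair : ∀ A : Finset (FermionTorus 2 L), A.card = m → p (pairSet A A)) :
    -(gibbsState β ((hubbardTorusTT' L 1 t' U).toBlock p p)
        ((hubbardTorusTT' L 1 t' 0).toBlock p p)).re ≤
      256 * (1 + |t'|) ^ 2 * m / (-U) + Real.log (Fintype.card {a // p a}) / β := by
  set τ : ℝ := 1 + |t'| with hτdef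
  have hτ : 0 < τ := by positivity
  set a : ℝ := -U / (16 * τ) with ha
  have ha0 : 0 < a := div_pos (neg_pos.2 hU) (by positivity)
  obtain ⟨hω1, hωa⟩ := one_le_add_inv_and_le_sub_inv ha0
  set ω : ℝ := a + a⁻¹ with hωdef
  set D : Matrix (Finset (Orb (FermionTorus 2 L))) (Finset (Orb (FermionTorus 2 L))) ℂ :=
    ∑ x : FermionTorus 2 L, numberOp x 0 * numberOp x 1 with hD
  set H := hubbardTorusTT' L 1 t' U with hH
  set H₀ := hubbardTorusTT' L 1 t' 0 with hH₀
  have hHp : (H.toBlock p p).IsHermitian := (hubbardTorusTT'_isHermitian L 1 t' U).submatrix _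
  have hZ : partitionFn β (H.toBlock p p) ≠ 0 := fun h =>
    (partitionFn_re_pos hHp β).ne' (by rw [h, Complex.zero_re])
  -- operator identities `H = H₀ + U D`, `H(U/2) = H₀ + (U/2) D`
  have hHU : H = H₀ + (U : ℂ) • D := by
    rw [hH, hH₀, hD, hubbardTorusTT'_eq_add_smul_doubleOcc t' 0 U, sub_zero]
  have hH2 : hubbardTorusTT' L 1 t' (U / 2) = H₀ + ((U / 2 : ℝ) : ℂ) • D := by
    rw [hH₀, hD, hubbardTorusTT'_eq_add_smul_doubleOcc t' 0 (U / 2), sub_zero]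
  -- the two Gibbs quantities `k = ⟨-T⟩_β`, `d = ⟨D⟩_β ≥ 0`
  set k : ℝ := -(gibbsState β (H.toBlock p p) (H₀.toBlock p p)).re with hk
  have hk' : (gibbsState β (H.toBlock p p) (H₀.toBlock p p)).re = -k := by rw [hk, neg_neg]
  set d : ℝ := (gibbsState β (H.toBlock p p) (D.toBlock p p)).re with hd
  have hd0 : 0 ≤ d := by
    have h := gibbsState_nonneg_of_posSemidef β hHp
      ((posSemidef_doubleOcc (L := L)).submatrix (Subtype.val : {a // p a} → _))
    exact (Complex.nonneg_iff.1 h).1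
  -- (1) the thermal upper bracket `Re⟨H⟩_β ≤ U m + (log N_p)/β`
  have hup : -k + U * d ≤ U * m + Real.log (Fintype.card {a // p a}) / β := by
    have h1 := re_gibbsState_self_le_groundEnergy_add hHp hβ
    have hcard : m ≤ (Finset.univ : Finset (FermionTorus 2 L)).card := by
      rw [Finset.card_univ, NoGo.card_fermionTorus_two]; exact hm
    obtain ⟨A, -, hA⟩ := Finset.exists_subset_card_eq hcard
    have hE0 : (H.toBlock p p).groundEnergy ≤ U * m := by
      have h := groundEnergy_toBlock_le_re_apply (hubbardTorusTT'_isHermitian L 1 t' U) p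
        (pairSet A A) (hpair A hA)
      rw [re_hubbardTorusTT'_apply_pairSet, hA] at h
      exact h
    have hsplit : (gibbsState β (H.toBlock p p) (H.toBlock p p)).re = -k + U * d := by
      have e : H.toBlock p p = H₀.toBlock p p + (U : ℂ) • D.toBlock p p := by
        conv_lhs => rw [hHU]
        ext i j
        rfl
      rw [congrArg (gibbsState β (H.toBlock p p)) e, map_add, map_smul, Complex.add_re, smul_eq_mul,
        Complex.re_ofReal_mul, hk', ← hd]
    linarith
  -- (2) the floor at `U/2`, read in the Gibbs state (`c₂ ≥ 0` coefficient of `D`, constant `c₁`)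
  set c₂ : ℝ := U / 2 + 8 * τ * (ω - ω⁻¹) with hc₂
  set c₁ : ℝ := 4 * ω * τ * ((2 * m : ℕ) : ℝ) with hc₁
  have hlow : -(4 * ω * τ * (2 * m)) + c₂ * d ≤ -k + U / 2 * d := by
    have hpsd : ((hubbardTorusTT' L 1 t' (U / 2) - ((c₂ : ℝ) : ℂ) • D + ((c₁ : ℝ) : ℂ) • 1).toBlock
        p p).PosSemidef :=
      posSemidef_toBlock_pairBreakingDefect t' (U / 2) hω1 (2 * m) p hpN
    have h0 := gibbsState_nonneg_of_posSemidef β hHp hpsd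
    have hexp : (hubbardTorusTT' L 1 t' (U / 2) - ((c₂ : ℝ) : ℂ) • D + ((c₁ : ℝ) : ℂ) • 1).toBlock
        p p = H₀.toBlock p p + ((U / 2 : ℝ) : ℂ) • D.toBlock p p - ((c₂ : ℝ) : ℂ) • D.toBlock p p +
          ((c₁ : ℝ) : ℂ) • Matrix.toBlock 1 p p := by
      rw [hH2]
      ext i j
      rfl
    rw [hexp, toBlock_one_self, map_add, map_sub, map_add, map_smul, map_smul, map_smul,
      gibbsState_one β _ hZ] at h0
    have h1 := (Complex.nonneg_iff.1 h0).1
    simp only [Complex.add_re, Complex.sub_re, smul_eq_mul, Complex.re_ofReal_mul, mul_one,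
      Complex.ofReal_re, ← hd, hk'] at h1
    rw [hc₁] at h1
    push_cast at h1
    linarith
  exact kin_le_of_brackets_arith_thermal hU hτ hd0 ha hωdef hωa hlow hup

/-- **Thm 9(v) (thermal kinetic ceiling, `t–t'` class; PROVED below).** `L ≥ 1`, any real `t'`,
`U < 0`, `β > 0`, `m ≤ L²`, `τ = 1 + |t'|`, `p` the `(2m, S^z = 0)` coordinate sector
(`|s| = 2m`, `2 · #{i ∈ s : spin i = 0} = 2m`, the convention of route `LogColdTorus`),
`N_p = dim p = binom(L², m)²`: the sector Gibbs state has
`⟨-T_{tt'}⟩_{β,p} = -Re⟨H^{tt'}(0)|_p⟩_{β,p} ≤ 256 τ² m/|U| + (log N_p)/β`. kind: support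
(PROVED). Why it might fail: it cannot; informative only for `|U| ≳ 32τ` and `T ≲ t²/|U|`.
Sources: MicnasRanningerRobaszkiewicz1990 §IV; HazraVermaRanderia2019 App. G; this cell
(Thm 9(i),(ii),(vi)). -/
@[conjecture] def ThermalAttractiveKineticCeilingDensityTT' : Prop :=
  ∀ (L : ℕ) [NeZero L] (t' U β : ℝ) (m : ℕ), U < 0 → 0 < β → m ≤ L ^ 2 →
    let p : Finset (Orb (FermionTorus 2 L)) → Prop := fun s =>
      s.card = 2 * m ∧ 2 * (s.filter fun i => (ofLex i).2 = 0).card = 2 * m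
    (-(gibbsState β ((hubbardTorusTT' L 1 t' U).toBlock p p)
        ((hubbardTorusTT' L 1 t' 0).toBlock p p)).re) ≤
      256 * (1 + |t'|) ^ 2 * m / (-U) + Real.log (Fintype.card {s // p s}) / β

omit [NeZero L] in
/-- The fully paired configurations lie in the `(2m, S^z = 0)` coordinate sector. -/
theorem pairSet_mem_spinZeroSector {m : ℕ} (A : Finset (FermionTorus 2 L)) (hA : A.card = m) :
    (pairSet A A).card = 2 * m ∧
      2 * ((pairSet A A).filter fun i => (ofLex i).2 = 0).card = 2 * m := by
  refine ⟨by rw [card_pairSet, hA, two_mul], ?_⟩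
  rw [filter_spin_zero_pairSet_eq, card_pairSet, hA, Finset.card_empty, add_zero]

/-- **`ThermalAttractiveKineticCeilingDensityTT'` holds.** -/
theorem thermalAttractiveKineticCeilingDensityTT'_holds :
    ThermalAttractiveKineticCeilingDensityTT' := by
  intro L _ t' U β m hU hβ hm
  dsimp only
  haveI := nonempty_spinZeroSector (L := L) hm
  exact neg_re_gibbsState_hopping_le_attractive_density t' hU hβ hm _ (fun s hs => hs.1)
    (fun A hA => pairSet_mem_spinZeroSector A hA)

end Summit.HubbardSuperconductivity.HubbardLadder.Bounds

end
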